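import Mathlib
import HarnessLib
import Literature.Probability.MarkovChains.MetropolisHastings
import Summits.Ventures.LatticeQCDFlow.Exactness.LocalUpdates

/-!
# The heat-bath (Gibbs) update is exact: resampling one block from its conditional law

HONEST FRAMING: exact (Metropolis-corrected) sampling algorithms for lattice gauge theory;
figures of merit are autocorrelation/cost numbers at stated couplings and volumes; no
continuum-physics claim.

Venture `LatticeQCDFlow` (cell pub-lqcd), topic `Exactness`; FANOUT row 9 (`eng-latcore`, the
`latflow.core` engine: `updates.sweep(f, beta, 'hb', rng)` — Cabibbo–Marinari SU(2)-subgroup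
heat bath with Kennedy–Pendleton / Creutz sampling; `cpn_2d` / `sun_2d` / `u1_2d` heat baths).
NEW WORK of the cell (elementary finite sums); the printed names appear in docstrings only,
nothing is cited as a fact.

## Content

On a finite product `X × Y` with weight `π`, the HEAT BATH of the block `X` at frozen complement
`y` draws the new `x'` from the conditional law `π (x', y) / Z y`, `Z y = ∑ x, π (x, y)`,
regardless of the old `x`:

* `heatBathRow π y x x' = π (x', y) / Z π y` (independent of `x`);
* `heatBathRow_detailedBalance` — each row kernel is in detailed balance with the conditional
  weight `x ↦ π (x, y)` (no hypothesis at all: both sides equal `π (x, y) π (x', y) / Z y`);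
* `heatBathRow_sum_eq_one` (when `Z y ≠ 0`), `heatBathRow_nonneg` (when `π ≥ 0`);
* `heatBathRow_idempotent` — resampling twice is resampling once (`K ∘ K = K`, when `Z y ≠ 0`):
  the heat bath is a projection, which is why n consecutive heat baths of the SAME block are a
  waste and the engine interleaves blocks / over-relaxation instead;
* `heatBathKernel π = blockKernel (heatBathRow π)` — the full-space kernel "resample `x`, keep
  `y`" — and `heatBathKernel_detailedBalance` / `_isStationary` / `_sum_eq_one` / `_nonneg` via
  the frozen-block lemmas of `LocalUpdates.lean`.

Dictionary: one Cabibbo–Marinari hit = the heat bath of the coordinate "SU(2)-subgroup element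
`a` of link `U_μ(x)`" with everything else frozen (its conditional density ∝ `√(1-a₀²) e^{β k a₀}`
is what Kennedy–Pendleton / Creutz sample exactly — acceptance test A3 of the engine checks that
law by histogram); a CP(N-1) site heat bath = the block `z(x)`; a full sweep = a sequential scan
of such kernels (`SequentialScanAdjoint.lean`), each exact by this file.
-/

namespace Summit.Ventures.LatticeQCDFlow.Exactness

open Finset
open Literature.Probability.MarkovChains

variable {X Y : Type*} [Fintype X] [Fintype Y] [DecidableEq Y]

/-- The conditional normaliser `Z y = ∑ x, π (x, y)`. -/
noncomputable def condZ (π : X × Y → ℝ) (y : Y) : ℝ := ∑ x, π (x, y)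

/-- The heat-bath row kernel of the `X`-block at frozen `y`: the new `x'` is drawn from the
conditional law, independently of the old `x`. -/
noncomputable def heatBathRow (π : X × Y → ℝ) (y : Y) (_x x' : X) : ℝ := π (x', y) / condZ π y

omit [Fintype Y] [DecidableEq Y] in
/-- The heat-bath row does not depend on the current value of the block. -/
theorem heatBathRow_const (π : X × Y → ℝ) (y : Y) (x₁ x₂ x' : X) :
    heatBathRow π y x₁ x' = heatBathRow π y x₂ x' := rfl

omit [Fintype Y] [DecidableEq Y] in
/-- **Detailed balance of the heat bath** with respect to the conditional weight — unconditionally. -/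
theorem heatBathRow_detailedBalance (π : X × Y → ℝ) (y : Y) :
    DetailedBalance (fun x => π (x, y)) (heatBathRow π y) := by
  intro x x'
  simp only [heatBathRow]
  ring

omit [Fintype Y] [DecidableEq Y] in
/-- The heat-bath row is stochastic when the conditional normaliser is non-zero. -/
theorem heatBathRow_sum_eq_one {π : X × Y → ℝ} {y : Y} (hZ : condZ π y ≠ 0) (x : X) :
    ∑ x', heatBathRow π y x x' = 1 := by
  simp only [heatBathRow]
  rw [← sum_div]
  exact div_self hZ

omit [Fintype Y] [DecidableEq Y] in
/-- The heat-bath row is entrywise non-negative for a non-negative weight. -/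
theorem heatBathRow_nonneg {π : X × Y → ℝ} (hπ : ∀ a, 0 ≤ π a) (y : Y) (x x' : X) :
    0 ≤ heatBathRow π y x x' :=
  div_nonneg (hπ _) (sum_nonneg fun _ _ => hπ _)

omit [Fintype Y] [DecidableEq Y] in
/-- The heat bath leaves the conditional weight stationary. -/
theorem heatBathRow_isStationary {π : X × Y → ℝ} {y : Y} (hZ : condZ π y ≠ 0) :
    IsStationary (fun x => π (x, y)) (heatBathRow π y) :=
  (heatBathRow_detailedBalance π y).isStationary (heatBathRow_sum_eq_one hZ)

omit [Fintype Y] [DecidableEq Y] in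
/-- **The heat bath is a projection**: resampling the same block twice in a row is resampling it
once (`K ∘ K = K`). -/
theorem heatBathRow_idempotent {π : X × Y → ℝ} {y : Y} (hZ : condZ π y ≠ 0) (x x'' : X) :
    ∑ x', heatBathRow π y x x' * heatBathRow π y x' x'' = heatBathRow π y x x'' := by
  have h : ∀ x', heatBathRow π y x x' * heatBathRow π y x' x'' = heatBathRow π y x x' * heatBathRow π y x x'' :=
    fun x' => rfl
  simp_rw [h, ← sum_mul, heatBathRow_sum_eq_one hZ x, one_mul]

/-- The full-space heat-bath kernel of the `X`-block: resample `x` from its conditional, keep `y`. -/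
noncomputable def heatBathKernel (π : X × Y → ℝ) : X × Y → X × Y → ℝ := blockKernel (heatBathRow π)

omit [Fintype Y] in
/-- On the same complement the heat-bath kernel is the conditional law of the new block value. -/
theorem heatBathKernel_same (π : X × Y → ℝ) (x x' : X) (y : Y) :
    heatBathKernel π (x, y) (x', y) = π (x', y) / condZ π y := by
  simp [heatBathKernel, blockKernel_same, heatBathRow]

omit [Fintype Y] in
/-- **The block heat bath is in detailed balance with `π`** (no hypothesis). -/
theorem heatBathKernel_detailedBalance (π : X × Y → ℝ) : DetailedBalance π (heatBathKernel π) :=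
  blockKernel_detailedBalance fun y => heatBathRow_detailedBalance π y

/-- The block heat bath is stochastic when every conditional normaliser is non-zero. -/
theorem heatBathKernel_sum_eq_one {π : X × Y → ℝ} (hZ : ∀ y, condZ π y ≠ 0) (a : X × Y) :
    ∑ b, heatBathKernel π a b = 1 :=
  blockKernel_sum_eq_one (fun y x => heatBathRow_sum_eq_one (hZ y) x) a

/-- **The block heat bath leaves `π` stationary** (when every conditional normaliser is non-zero,
e.g. `π > 0`). -/
theorem heatBathKernel_isStationary {π : X × Y → ℝ} (hZ : ∀ y, condZ π y ≠ 0) :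
    IsStationary π (heatBathKernel π) :=
  (heatBathKernel_detailedBalance π).isStationary (heatBathKernel_sum_eq_one hZ)

omit [Fintype Y] in
/-- The block heat bath is entrywise non-negative for a non-negative weight. -/
theorem heatBathKernel_nonneg {π : X × Y → ℝ} (hπ : ∀ a, 0 ≤ π a) (a b : X × Y) :
    0 ≤ heatBathKernel π a b :=
  blockKernel_nonneg (fun y x x' => heatBathRow_nonneg hπ y x x') a b

omit [Fintype Y] [DecidableEq Y] in
/-- A strictly positive weight has non-zero conditional normalisers (the hypothesis above). -/
theorem condZ_ne_zero_of_pos [Nonempty X] {π : X × Y → ℝ} (hπ : ∀ a, 0 < π a) (y : Y) : condZ π y ≠ 0 :=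
  (sum_pos (fun x _ => hπ (x, y)) univ_nonempty).ne'

end Summit.Ventures.LatticeQCDFlow.Exactness
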